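import Mathlib
import Summits.ResolutionOfSingularities.ResolutionOfSingularities.Theorems.RadicialJungCleanModelsContactChainUncharged
import HarnessLib

/-!
# Route `RadicialJung`, crux `CleanModels` (stmt-ResolutionOfSingularities-15917), line `Sketch` rev 35, stub 6 `stub_cleanProp44` (X44c),
# work plan O8 / L7b: the chain with TRACKED UNITS, residual rationality along the chain, and the form (2) exit DECIDED AT THE STARTING POINT

Memo `Cruxes/CleanModels/Lines/Sketch-memo-hand2-g8-stubs-5-7.md` §2 (T1), local half.  At an uncharged landing (`p ∣ N = Σ k_i a_i`) the line reads
`U · q^p`; whether the form-(2) exit applies depends on the residue of `U`.  The opaque units of ✓ `contact_along_pointChain` hide it; here they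
are tracked: along a chain of point blowing ups following the curve, with `σ^#(w) = Ω · e` (`Ω` a unit),
`σ^#(γ w^k + s₀) = e^{min(n,k)} · (σ^#(γ) · Ω^k · e^{k−n} + π')` EXACTLY (no further unit), so that at an uncharged landing
`U ≡ σ^#(u₀ ∏ γ_i^{a_i}) · Ω^N (mod 𝓘_C)` and, `p ∣ N`, the class of `U` modulo `p`-th powers is that of `σ^#(u₀ ∏ γ_i^{a_i})`.  Since the chain is
residually rational (`𝒪_{X₀,x₀} → 𝒪_{X,x}/𝓘_{C,x}` is onto), «the residue of `u₀ ∏ γ_i^{a_i}` is not a `p`-th power in `κ(x₀)`» decides the exit.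

* `contact_drop_tracked` — one point blowing up with a GIVEN generator `e` of the exceptional ideal at `c'`: transversality `𝓘_{C̃} + (e) = 𝔪'`,
  `𝓘_C 𝒪' ⊆ e·𝓘_{C̃}`, a unit `w₁` with `π^#(w) = e · w₁`; `exists_sub_stalkMap_mem_of_point_strictTransform` — residual rationality
  `∀ y, ∃ a, y − π^# a ∈ 𝓘_{C̃,c'}` (the tree's `exists_sub_stalkMap_mem_stalkIdeal_strictTransformIdeal_of_transverse` at a point of `C̃`).
* `contact_family_tracked_along_pointChain` — the tracked family theorem (see above) plus residual rationality along the chain.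
* `cleanPermissibleAt_of_pointChain_uncharged_of_residue` — **form (2) exit decided at `x₀`**: transversal presentation
  `u₀ · ∏_i (γ_i w^{k_i} + s₀ᵢ)^{a_i}`, `n ≥ max k_i`, `p ∣ Σ k_i a_i`, and `u₀ ∏ γ_i^{a_i} − c^p ∉ 𝔪_{x₀}` for every `c` ⟹ the line of `σ^♯G` is
  clean-permissible for the strict transform at the end point (✓ `cleanPermissibleAt_of_unit_mul_pow`).
What remains of (T1) after this: the case where that residue IS a `p`-th power (restart with `U − c^p`; termination = best `p`-th-power
approximation in the excellent DVR `𝒪_{C,x}`, ✓ `Ccurve.dichotomy_of_best_approx` + a defectless-DVR fact, memo §2).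

Honest framing: OURS (elementary); nothing here proves resolution in characteristic `p`, X44c, or any case of `CleanModels`.
-/

noncomputable section

set_option linter.dupNamespace false -- mandated namespace of this single-conjunct summit

open CategoryTheory AlgebraicGeometry TopologicalSpace IsLocalRing
open Literature.AlgebraicGeometry.Resolution Literature.AlgebraicGeometry.Motives
open Scheme.IdealSheafData

universe u

namespace Summit.ResolutionOfSingularities.ResolutionOfSingularities.Theorems.RadicialJung.CleanModels

/-- **One point blowing up, tracked.**  See the module docstring. [cite: CossartPiltant2008, Prop. 4.4 (proof, p. 10)]
[cite: StacksProject, Tag 080E] -/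
theorem contact_drop_tracked {X X' : Scheme.{u}} [IsLocallyNoetherian X] [IsLocallyNoetherian X'] {π : X' ⟶ X}
    (hX : Scheme.IsRegular X) {c' : X'} (hx : IsClosed ({π c'} : Set X))
    (hYreg : Scheme.IsRegular (vanishingIdeal (⟨{π c'}, hx⟩ : Closeds X)).subscheme)
    (hπ : IsBlowup π (vanishingIdeal (⟨{π c'}, hx⟩ : Closeds X))) {C : Closeds X}
    (hCreg : ∀ y ∈ (C : Set X), ∃ c : Fin 2 → X.presheaf.stalk y,
      IsRsopPart c ∧ Ideal.span (Set.range c) = stalkIdeal (vanishingIdeal C) y)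
    (hxC : π c' ∈ (C : Set X)) (hdim : ringKrullDim (X.presheaf.stalk (π c')) = 3)
    (hc' : c' ∈ closure (π ⁻¹' ((C : Set X) \ {π c'})))
    (w : X.presheaf.stalk (π c')) (hw : stalkIdeal (vanishingIdeal C) (π c') ⊔ Ideal.span {w} = maximalIdeal _)
    (e : X'.presheaf.stalk c') (he0 : e ∈ nonZeroDivisors (X'.presheaf.stalk c'))
    (he : stalkIdeal ((vanishingIdeal (⟨{π c'}, hx⟩ : Closeds X)).comap π) c' = Ideal.span {e}) :
    stalkIdeal (vanishingIdeal (⟨closure (π ⁻¹' ((C : Set X) \ {π c'})), isClosed_closure⟩ : Closeds X')) c' ⊔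
        Ideal.span {e} = maximalIdeal _ ∧
      (stalkIdeal (vanishingIdeal C) (π c')).map (π.stalkMap c').hom ≤
        Ideal.span {e} * stalkIdeal (vanishingIdeal (⟨closure (π ⁻¹' ((C : Set X) \ {π c'})), isClosed_closure⟩ : Closeds X')) c' ∧
      (∃ w₁ : X'.presheaf.stalk c', IsUnit w₁ ∧ (π.stalkMap c').hom w = e * w₁) := by
  set Y : Closeds X := ⟨{π c'}, hx⟩
  set Ct : Closeds X' := ⟨closure (π ⁻¹' ((C : Set X) \ {π c'})), isClosed_closure⟩
  have hPle : stalkIdeal (vanishingIdeal C) (π c') ≤ maximalIdeal _ :=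
    (mem_support_iff_stalkIdeal_le _ _).mp
      (by rw [← SetLike.mem_coe, Scheme.IdealSheafData.coe_support_vanishingIdeal]; exact hxC)
  have htr : ∀ y ∈ (C : Set X) ∩ Y, stalkIdeal (vanishingIdeal C) y ⊔ stalkIdeal (vanishingIdeal Y) y = maximalIdeal _ := by
    rintro y ⟨-, hy⟩
    have hy' : y = π c' := hy
    subst hy'
    rw [stalkIdeal_vanishingIdeal_singleton hx]
    exact sup_eq_right.mpr hPle
  have hdim' : ∀ y ∈ (C : Set X) ∩ Y, ringKrullDim (X.presheaf.stalk y) = 3 := by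
    rintro y ⟨-, hy⟩
    have hy' : y = π c' := hy
    subst hy'
    exact hdim
  have hIeq : vanishingIdeal Ct = strictTransformIdeal π (vanishingIdeal Y) (vanishingIdeal C) :=
    (vanishingIdeal_closure_eq_strictTransformIdeal_of_transverse hπ hCreg htr hdim').1
  have htrans : stalkIdeal (vanishingIdeal Ct) c' ⊔ stalkIdeal ((vanishingIdeal Y).comap π) c' = maximalIdeal _ :=
    (exists_isRsopPart_strictTransform_of_transverse hπ hCreg htr hdim' hX hYreg hc').2 (Set.mem_singleton _)
  set φ := (π.stalkMap c').hom with hφ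
  set P := stalkIdeal (vanishingIdeal C) (π c') with hP
  set P' := stalkIdeal (vanishingIdeal Ct) c' with hP'
  have hP'le : P' ≤ maximalIdeal _ :=
    (mem_support_iff_stalkIdeal_le _ _).mp
      (by rw [← SetLike.mem_coe, Scheme.IdealSheafData.coe_support_vanishingIdeal]; exact hc')
  have hmx : (maximalIdeal (X.presheaf.stalk (π c'))).map φ = Ideal.span {e} := by
    rw [← stalkIdeal_vanishingIdeal_singleton hx, hφ, ← stalkIdeal_comap_eq_map_stalkMap, he]
  have hmle : (P ⊔ Ideal.span {w}).map φ ≤ Ideal.span {e} := by rw [hP, hw, hmx]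
  have hemem : e ∈ (P ⊔ Ideal.span {w}).map φ := by rw [hP, hw, hmx]; exact Ideal.mem_span_singleton_self e
  have hPP' : P.map φ ≤ Ideal.span {e} * P' := by
    have hCY : vanishingIdeal C ≤ vanishingIdeal Y :=
      vanishingIdeal_antimono (fun z hz => by have hz' : z = π c' := hz; subst hz'; exact hxC)
    have hle1 : (vanishingIdeal C).comap π ≤ (vanishingIdeal Y).comap π ^ 1 := by
      rw [pow_one]; exact comap_mono _ hCY
    have hprod := hπ.pow_mul_controlledTransform_eq hle1
    have hst : (vanishingIdeal C).comap π ≤ (vanishingIdeal Y).comap π * vanishingIdeal Ct := by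
      rw [hIeq, ← hprod, pow_one]
      exact (show (vanishingIdeal Y).comap π * controlledTransform π (vanishingIdeal Y) (vanishingIdeal C) 1 ≤
          (vanishingIdeal Y).comap π * strictTransformIdeal π (vanishingIdeal Y) (vanishingIdeal C) from
        fun U => Ideal.mul_mono_right (controlledTransform_le_strictTransformIdeal _ _ _ _ U))
    calc P.map φ = stalkIdeal ((vanishingIdeal C).comap π) c' := by rw [hP, hφ, stalkIdeal_comap_eq_map_stalkMap]
      _ ≤ stalkIdeal ((vanishingIdeal Y).comap π * vanishingIdeal Ct) c' := stalkIdeal_mono hst c'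
      _ = Ideal.span {e} * P' := by rw [stalkIdeal_mul, he, hP']
  obtain ⟨w₁, hw₁, hww⟩ := exists_unit_map_transversal_eq_mul φ e he0 P P' hP'le w hmle hemem hPP'
  exact ⟨by rw [← he]; exact htrans, hPP', ⟨w₁, hw₁, hww⟩⟩

/-- **Residual rationality of the point of the strict transform** (one point blowing up): `𝒪_{X,x} → 𝒪_{X',c'}/𝓘_{C̃,c'}` is onto.
[cite: StacksProject, Tag 080E] [cite: CossartPiltant2008, Prop. 4.4 (proof, p. 10)] -/
theorem exists_sub_stalkMap_mem_of_point_strictTransform {X X' : Scheme.{u}} [IsLocallyNoetherian X] [IsLocallyNoetherian X']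
    {π : X' ⟶ X} {Y C : Closeds X} (hπ : IsBlowup π (vanishingIdeal Y))
    (hCreg : ∀ y ∈ (C : Set X), ∃ c : Fin 2 → X.presheaf.stalk y,
      IsRsopPart c ∧ Ideal.span (Set.range c) = stalkIdeal (vanishingIdeal C) y)
    (htr : ∀ y ∈ (C : Set X) ∩ Y, stalkIdeal (vanishingIdeal C) y ⊔ stalkIdeal (vanishingIdeal Y) y = maximalIdeal _)
    (hdim : ∀ y ∈ (C : Set X) ∩ Y, ringKrullDim (X.presheaf.stalk y) = 3)
    {c' : X'} (hc' : c' ∈ closure (π ⁻¹' ((C : Set X) \ Y))) (y : X'.presheaf.stalk c') :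
    ∃ a : X.presheaf.stalk (π c'), y - (π.stalkMap c').hom a ∈
      stalkIdeal (vanishingIdeal (⟨closure (π ⁻¹' ((C : Set X) \ Y)), isClosed_closure⟩ : Closeds X')) c' := by
  have hIeq := (vanishingIdeal_closure_eq_strictTransformIdeal_of_transverse hπ hCreg htr hdim).1
  have hc'supp : c' ∈ ((strictTransformIdeal π (vanishingIdeal Y) (vanishingIdeal C)).support : Set X') := by
    rw [support_strictTransformIdeal_eq_closure, coe_support_vanishingIdeal, coe_support_vanishingIdeal]
    exact hc'
  rw [hIeq]
  obtain ⟨v', hv'⟩ : c' ∈ Set.range (strictTransformIdeal π (vanishingIdeal Y) (vanishingIdeal C)).subschemeι := by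
    rw [range_subschemeι]; exact hc'supp
  subst hv'
  exact exists_sub_stalkMap_mem_stalkIdeal_strictTransformIdeal_of_transverse hπ hCreg htr hdim v' y

/-- **The tracked family along a chain of point blowing ups, with residual rationality.**  See the module docstring.
[cite: CossartJannsenSaito2020, proof of Thm. 6.28, Step 5] [cite: CossartPiltant2008, Prop. 4.4 (proof, p. 10)] -/
theorem contact_family_tracked_along_pointChain {X₀ X : Scheme.{u}} {σ : X ⟶ X₀} {C₀ : Closeds X₀} {C : Closeds X} {x : X} {n : ℕ}
    (h : IsPointChainAlong σ C₀ C x n) [IsLocallyNoetherian X₀] [IsLocallyNoetherian X] (hX₀ : Scheme.IsRegular X₀)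
    (hC₀reg : ∀ y ∈ (C₀ : Set X₀), ∃ c : Fin 2 → X₀.presheaf.stalk y,
      IsRsopPart c ∧ Ideal.span (Set.range c) = stalkIdeal (vanishingIdeal C₀) y)
    (hxC₀ : σ x ∈ (C₀ : Set X₀)) (hdim₀ : ringKrullDim (X₀.presheaf.stalk (σ x)) = 3)
    (w : X₀.presheaf.stalk (σ x)) (hw : stalkIdeal (vanishingIdeal C₀) (σ x) ⊔ Ideal.span {w} = maximalIdeal _)
    {m : ℕ} (γ s₀ : Fin m → X₀.presheaf.stalk (σ x))
    (hs₀ : ∀ i, s₀ i ∈ stalkIdeal (vanishingIdeal C₀) (σ x)) (k : Fin m → ℕ) :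
    Scheme.IsRegular X ∧
    (∀ y ∈ (C : Set X), ∃ c : Fin 2 → X.presheaf.stalk y, IsRsopPart c ∧ Ideal.span (Set.range c) = stalkIdeal (vanishingIdeal C) y) ∧
    x ∈ (C : Set X) ∧ ringKrullDim (X.presheaf.stalk x) = 3 ∧
    (∀ y : X.presheaf.stalk x, ∃ a : X₀.presheaf.stalk (σ x), y - (σ.stalkMap x).hom a ∈ stalkIdeal (vanishingIdeal C) x) ∧
    ∃ e Ω : X.presheaf.stalk x, stalkIdeal (vanishingIdeal C) x ⊔ Ideal.span {e} = maximalIdeal _ ∧ IsUnit Ω ∧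
      (σ.stalkMap x).hom w = Ω * e ∧
      ∀ i, ∃ π' : X.presheaf.stalk x, π' ∈ stalkIdeal (vanishingIdeal C) x ∧
        (σ.stalkMap x).hom (γ i * w ^ k i + s₀ i) =
          e ^ min n (k i) * ((σ.stalkMap x).hom (γ i) * Ω ^ k i * e ^ (k i - n) + π') := by
  induction h with
  | nil C₀ x₀ =>
    refine ⟨hX₀, hC₀reg, hxC₀, hdim₀, fun y => ⟨y, ?_⟩, w, 1, hw, isUnit_one, ?_, fun i => ⟨s₀ i, hs₀ i, ?_⟩⟩
    · have : (Scheme.Hom.stalkMap (𝟙 X₀) x₀).hom y = y := by rw [Scheme.Hom.stalkMap_id]; rfl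
      rw [this, sub_self]
      exact Ideal.zero_mem _
    · rw [Scheme.Hom.stalkMap_id]; simp only [one_mul]; rfl
    · rw [Scheme.Hom.stalkMap_id]
      simp only [Nat.zero_min, pow_zero, one_mul, Nat.sub_zero, one_pow, mul_one]
      rfl
  | @cons X X' _ _ σ C₀ C n τ x' hx hchain hYreg hτ hx' ih =>
    obtain ⟨hX, hCreg, hxC, hdim, hsurj, e, Ω, he, hΩ, hwimg, hfam⟩ := ih hC₀reg hxC₀ hdim₀ w hw γ s₀ hs₀
    obtain ⟨hX', hC'reg, hdim'⟩ := strictTransform_curve_data_of_isBlowup_point hX hx hYreg hτ hCreg hxC hdim hx'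
    haveI : IsRegularLocalRing (X'.presheaf.stalk x') := hX' x'
    have hPle : stalkIdeal (vanishingIdeal C) (τ x') ≤ maximalIdeal _ := le_sup_left.trans he.le
    -- ONE generator `e'` of the exceptional ideal at `x'`, and the tracked step for the coordinate `e`
    obtain ⟨e', he'0, he'gen⟩ := hτ.isEffectiveCartier.exists_stalkIdeal_eq_span x'
    obtain ⟨htr', hPP', ⟨w₁, hw₁, heimg⟩⟩ :=
      contact_drop_tracked hX hx hYreg hτ hCreg hxC hdim hx' e he e' he'0 he'gen
    -- residual rationality of this step
    have hsurj' : ∀ y : X'.presheaf.stalk x', ∃ b : X.presheaf.stalk (τ x'), y - (τ.stalkMap x').hom b ∈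
        stalkIdeal (vanishingIdeal (⟨closure (τ ⁻¹' ((C : Set X) \ {τ x'})), isClosed_closure⟩ : Closeds X')) x' := by
      have hPle0 : stalkIdeal (vanishingIdeal C) (τ x') ≤ maximalIdeal _ := hPle
      have htr0 : ∀ y ∈ (C : Set X) ∩ (⟨{τ x'}, hx⟩ : Closeds X),
          stalkIdeal (vanishingIdeal C) y ⊔ stalkIdeal (vanishingIdeal (⟨{τ x'}, hx⟩ : Closeds X)) y = maximalIdeal _ := by
        rintro y ⟨-, hy⟩
        have hy' : y = τ x' := hy
        subst hy'
        rw [stalkIdeal_vanishingIdeal_singleton hx]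
        exact sup_eq_right.mpr hPle0
      have hdim0 : ∀ y ∈ (C : Set X) ∩ (⟨{τ x'}, hx⟩ : Closeds X), ringKrullDim (X.presheaf.stalk y) = 3 := by
        rintro y ⟨-, hy⟩
        have hy' : y = τ x' := hy
        subst hy'
        exact hdim
      intro y
      exact exists_sub_stalkMap_mem_of_point_strictTransform hτ hCreg htr0 hdim0 hx' y
    -- compatibility of the composite stalk map
    have hcomp : ∀ a, ((τ ≫ σ).stalkMap x').hom a = (τ.stalkMap x').hom ((σ.stalkMap (τ x')).hom a) := fun a => by
      rw [Scheme.Hom.stalkMap_comp]; rfl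
    have hPmap : ∀ z ∈ stalkIdeal (vanishingIdeal C) (τ x'), (τ.stalkMap x').hom z ∈
        stalkIdeal (vanishingIdeal (⟨closure (τ ⁻¹' ((C : Set X) \ {τ x'})), isClosed_closure⟩ : Closeds X')) x' :=
      fun z hz => Ideal.mul_le_left (hPP' (Ideal.mem_map_of_mem _ hz))
    refine ⟨hX', hC'reg, hx', hdim', fun y => ?_, e', (τ.stalkMap x').hom Ω * w₁, htr', (hΩ.map _).mul hw₁, ?_, fun i => ?_⟩
    · -- residual rationality composes
      obtain ⟨b, hb⟩ := hsurj' y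
      obtain ⟨a, ha⟩ := hsurj b
      refine ⟨a, ?_⟩
      have : y - ((τ ≫ σ).stalkMap x').hom a = (y - (τ.stalkMap x').hom b) + (τ.stalkMap x').hom (b - (σ.stalkMap (τ x')).hom a) := by
        rw [hcomp, map_sub]; ring
      rw [this]
      exact Ideal.add_mem _ hb (hPmap _ ha)
    · have hwimg' : (σ.stalkMap (τ x')).hom w = Ω * e := hwimg
      rw [hcomp, hwimg', map_mul, heimg]
      ring
    · obtain ⟨π', hπ', hsimg⟩ := hfam i
      have hsimg' : (σ.stalkMap (τ x')).hom (γ i * w ^ k i + s₀ i) =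
          e ^ min n (k i) * ((σ.stalkMap (τ x')).hom (γ i) * Ω ^ k i * e ^ (k i - n) + π') := hsimg
      by_cases hnk : n < k i
      · obtain ⟨j, hj⟩ : ∃ j, k i = n + 1 + j := ⟨k i - (n + 1), by omega⟩
        have hmin : min n (k i) = n := Nat.min_eq_left hnk.le
        have hmin' : min (n + 1) (k i) = n + 1 := Nat.min_eq_left (by omega)
        rw [hmin, hj, show n + 1 + j - n = j + 1 by omega] at hsimg'
        obtain ⟨π₁, hπ₁, h1, -⟩ := contact_step_intrinsic (τ.stalkMap x').hom e' w₁ (stalkIdeal (vanishingIdeal C) (τ x')) _ hPP'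
          e ((σ.stalkMap (τ x')).hom (γ i) * Ω ^ (n + 1 + j)) 1 π' heimg hπ' (j + 1) (by omega) 0 0
        rw [Nat.add_sub_cancel] at h1
        refine ⟨w₁ ^ n * π₁, Ideal.mul_mem_left _ _ hπ₁, ?_⟩
        rw [hcomp, hcomp, hmin', hj, show n + 1 + j - (n + 1) = j by omega, hsimg', map_mul, map_pow, heimg, h1, map_mul, map_pow]
        ring
      · have hkn : k i ≤ n := Nat.le_of_not_lt hnk
        have hmin : min n (k i) = k i := Nat.min_eq_right hkn
        have hmin' : min (n + 1) (k i) = k i := Nat.min_eq_right (by omega)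
        have hsub : k i - n = 0 := Nat.sub_eq_zero_of_le hkn
        have hsub' : k i - (n + 1) = 0 := Nat.sub_eq_zero_of_le (by omega)
        refine ⟨w₁ ^ k i * (τ.stalkMap x').hom π', Ideal.mul_mem_left _ _ (hPmap _ hπ'), ?_⟩
        rw [hcomp, hcomp, hsimg', hmin, hsub, hmin', hsub', pow_zero, mul_one, pow_zero, mul_one, map_mul, map_pow, heimg, map_add,
          map_mul, map_pow]
        ring

/-- **Form (2) exit at an uncharged landing, decided at the starting point.**  See the module docstring.
[cite: CossartJannsenSaito2020, proof of Thm. 6.28, Step 5] [cite: Matsumura1987, Thm. 14.2] -/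
theorem cleanPermissibleAt_of_pointChain_uncharged_of_residue {X₀ X : Scheme.{u}} [IsIntegral X₀] [IsIntegral X] {σ : X ⟶ X₀}
    [IsDominant σ] {C₀ : Closeds X₀} {C : Closeds X} {x : X} {n : ℕ} (h : IsPointChainAlong σ C₀ C x n)
    [IsLocallyNoetherian X₀] [IsLocallyNoetherian X] (hX₀ : Scheme.IsRegular X₀)
    (hC₀reg : ∀ y ∈ (C₀ : Set X₀), ∃ c : Fin 2 → X₀.presheaf.stalk y,
      IsRsopPart c ∧ Ideal.span (Set.range c) = stalkIdeal (vanishingIdeal C₀) y)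
    (hxC₀ : σ x ∈ (C₀ : Set X₀)) (hdim₀ : ringKrullDim (X₀.presheaf.stalk (σ x)) = 3)
    (p : ℕ) (G : X₀.functionField) (cc : Fin p → X₀.functionField) (hcc : ∃ j : Fin p, (j : ℕ) ≠ 0 ∧ cc j ≠ 0)
    (w u₀ : X₀.presheaf.stalk (σ x)) (hw : stalkIdeal (vanishingIdeal C₀) (σ x) ⊔ Ideal.span {w} = maximalIdeal _)
    (hu₀ : IsUnit u₀) {m : ℕ} (γ s₀ : Fin m → X₀.presheaf.stalk (σ x)) (hγ : ∀ i, IsUnit (γ i))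
    (hs₀ : ∀ i, s₀ i ∈ stalkIdeal (vanishingIdeal C₀) (σ x)) (k a : Fin m → ℕ) (hkn : ∀ i, k i ≤ n)
    (hN : p ∣ ∑ i, k i * a i)
    (hres : ∀ c : X₀.presheaf.stalk (σ x), u₀ * ∏ i, γ i ^ a i - c ^ p ∉ maximalIdeal _)
    (hX : (∑ j : Fin p, cc j ^ p * G ^ (j : ℕ)) =
      RatFn.toFunctionField (σ x) (u₀ * ∏ i, (γ i * w ^ k i + s₀ i) ^ a i)) :
    CleanPermissibleAt p (RatFn.toFunctionField x) (RatFn.functionFieldMap σ G) (stalkIdeal (vanishingIdeal C) x) := by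
  classical
  obtain ⟨hXreg, hCreg, hxC, hdim, hsurj, e, Ω, he, hΩ, -, hfam⟩ :=
    contact_family_tracked_along_pointChain h hX₀ hC₀reg hxC₀ hdim₀ w hw γ s₀ hs₀ k
  haveI : IsRegularLocalRing (X.presheaf.stalk x) := hXreg x
  haveI := isDomain_of_isRegularLocalRing (X.presheaf.stalk x)
  obtain ⟨c2, hc2, hc2P⟩ := hCreg x hxC
  haveI : IsRegularLocalRing (X.presheaf.stalk x ⧸ stalkIdeal (vanishingIdeal C) x) := by
    rw [← hc2P]; exact hc2.isRegularLocalRing_quotient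
  have hP1 : ringKrullDim (X.presheaf.stalk x ⧸ stalkIdeal (vanishingIdeal C) x) = 1 := by
    rw [← hc2P]; exact ringKrullDim_quotient_span_pair_eq_one hc2 hdim
  have hPle : stalkIdeal (vanishingIdeal C) x ≤ maximalIdeal _ := le_sup_left.trans he.le
  have he0 : e ≠ 0 := by
    intro he0
    have hb := isRsopPart_quotient_singleton_of_sup_span_eq (stalkIdeal (vanishingIdeal C) x) hP1 e he
    have := hb.ne_zero 0
    simp [he0] at this
  choose π' hπ' hsimg using hfam
  set φ := (σ.stalkMap x).hom with hφ
  -- the per-member factor `W_i = σ^#(γ_i) Ω^{k_i} + π'_i` at the landing, and the exponent `N`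
  have hsimg' : ∀ i, φ (γ i * w ^ k i + s₀ i) = (φ (γ i) * Ω ^ k i + π' i) * e ^ k i := by
    intro i
    rw [hφ, hsimg i, Nat.min_eq_right (hkn i), Nat.sub_eq_zero_of_le (hkn i), pow_zero, mul_one]
    ring
  obtain ⟨N', hN'0⟩ := hN
  have hN' : ∑ i, k i * a i = N' * p := by rw [hN'0, mul_comm]
  set Ωinv : X.presheaf.stalk x := ↑(hΩ.unit⁻¹) with hΩinv
  have hΩΩinv : Ω * Ωinv = 1 := by rw [hΩinv]; exact IsUnit.mul_val_inv hΩ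
  have hone : Ωinv ^ (N' * p) * Ω ^ (N' * p) = 1 := by rw [← mul_pow, mul_comm, hΩΩinv, one_pow]
  set U : X.presheaf.stalk x := φ u₀ * (∏ i, (φ (γ i) * Ω ^ k i + π' i) ^ a i) * Ωinv ^ (N' * p) with hU
  set q : X.presheaf.stalk x := (Ω * e) ^ N' with hq
  have hq0 : q ≠ 0 := pow_ne_zero _ (mul_ne_zero hΩ.ne_zero he0)
  have hq' : q ^ p = Ω ^ (N' * p) * e ^ (N' * p) := by rw [hq, ← pow_mul, mul_pow]
  have himg : φ (u₀ * ∏ i, (γ i * w ^ k i + s₀ i) ^ a i) = U * q ^ p := by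
    rw [hq', hU, map_mul, map_prod]
    simp only [map_pow, hsimg', mul_pow, ← pow_mul, Finset.prod_mul_distrib, Finset.prod_pow_eq_pow_sum, hN']
    linear_combination (-(φ u₀ * (∏ i, (φ (γ i) * Ω ^ k i + π' i) ^ a i) * e ^ (N' * p))) * hone
  -- the residue of `U` is that of `σ^#(u₀ ∏ γ_i^{a_i})`
  have hUunit : IsUnit U := by
    refine ((hu₀.map _).mul (IsUnit.prod_univ_iff.mpr fun i => IsUnit.pow _ ?_)).mul ((hΩ.unit⁻¹).isUnit.pow _)
    by_contra hnu
    have hm : φ (γ i) * Ω ^ k i + π' i ∈ maximalIdeal (X.presheaf.stalk x) := (mem_maximalIdeal _).mpr hnu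
    have h2 : φ (γ i) * Ω ^ k i ∈ maximalIdeal (X.presheaf.stalk x) := by
      have := Ideal.sub_mem _ hm (hPle (hπ' i)); rwa [add_sub_cancel_right] at this
    exact (mem_maximalIdeal _).mp h2 (((hγ i).map _).mul (hΩ.pow _))
  have hUres : ∀ c' : X.presheaf.stalk x, U - c' ^ p ∉ maximalIdeal (X.presheaf.stalk x) := by
    intro c' hc'
    -- compare `U` with `σ^#(u₀ ∏ γ_i^{a_i})` modulo `𝔪`: work in the residue ring
    have hUv : U - φ (u₀ * ∏ i, γ i ^ a i) ∈ maximalIdeal (X.presheaf.stalk x) := by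
      rw [← Ideal.Quotient.eq_zero_iff_mem, map_sub, sub_eq_zero]
      have hπ0 : ∀ i, Ideal.Quotient.mk (maximalIdeal (X.presheaf.stalk x)) (π' i) = 0 := fun i =>
        Ideal.Quotient.eq_zero_iff_mem.mpr (hPle (hπ' i))
      have hΩq : Ideal.Quotient.mk (maximalIdeal (X.presheaf.stalk x)) Ω ^ (N' * p) *
          Ideal.Quotient.mk (maximalIdeal (X.presheaf.stalk x)) Ωinv ^ (N' * p) = 1 := by
        rw [← mul_pow, ← map_mul, hΩΩinv, map_one, one_pow]
      rw [hU]
      simp only [map_prod, map_pow, map_add, map_mul, hπ0, add_zero, mul_pow, ← pow_mul, Finset.prod_mul_distrib,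
        Finset.prod_pow_eq_pow_sum, hN']
      linear_combination (Ideal.Quotient.mk (maximalIdeal (X.presheaf.stalk x)) (φ u₀) *
        ∏ i, Ideal.Quotient.mk (maximalIdeal (X.presheaf.stalk x)) (φ (γ i)) ^ a i) * hΩq
    -- `c' ≡ σ^#(c)` for some `c` (residual rationality)
    obtain ⟨c, hc⟩ := hsurj c'
    have hcp : c' ^ p - φ (c ^ p) ∈ maximalIdeal (X.presheaf.stalk x) := by
      rw [map_pow]
      obtain ⟨r, hr⟩ := sub_dvd_pow_sub_pow c' (φ c) p
      rw [hr]
      exact Ideal.mul_mem_right _ _ (hPle hc)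
    have hkey : φ (u₀ * ∏ i, γ i ^ a i - c ^ p) ∈ maximalIdeal (X.presheaf.stalk x) := by
      have : φ (u₀ * ∏ i, γ i ^ a i - c ^ p) = (U - c' ^ p) - (U - φ (u₀ * ∏ i, γ i ^ a i)) + (c' ^ p - φ (c ^ p)) := by
        rw [map_sub]; ring
      rw [this]
      exact Ideal.add_mem _ (Ideal.sub_mem _ hc' hUv) hcp
    -- the stalk map is local
    apply hres c
    by_contra hnot
    have hunit : IsUnit (u₀ * ∏ i, γ i ^ a i - c ^ p) := by
      by_contra hnu; exact hnot ((mem_maximalIdeal _).mpr hnu)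
    exact (mem_maximalIdeal _).mp hkey (hunit.map _)
  -- conclude
  have hX' : (∑ j : Fin p, (RatFn.functionFieldMap σ (cc j)) ^ p * (RatFn.functionFieldMap σ G) ^ (j : ℕ)) =
      RatFn.toFunctionField x (U * q ^ p) := by
    calc (∑ j : Fin p, (RatFn.functionFieldMap σ (cc j)) ^ p * (RatFn.functionFieldMap σ G) ^ (j : ℕ))
        = RatFn.functionFieldMap σ (∑ j : Fin p, cc j ^ p * G ^ (j : ℕ)) := by
          rw [map_sum]; simp only [map_mul, map_pow]
      _ = RatFn.functionFieldMap σ (RatFn.toFunctionField (σ x) (u₀ * ∏ i, (γ i * w ^ k i + s₀ i) ^ a i)) := by rw [hX]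
      _ = RatFn.toFunctionField x ((σ.stalkMap x) (u₀ * ∏ i, (γ i * w ^ k i + s₀ i) ^ a i)) :=
          RatFn.functionFieldMap_toFunctionField σ x _
      _ = RatFn.toFunctionField x (U * q ^ p) := congrArg (RatFn.toFunctionField x) himg
  have hcc' : ∃ j : Fin p, (j : ℕ) ≠ 0 ∧ RatFn.functionFieldMap σ (cc j) ≠ 0 := by
    obtain ⟨j, hj, hj0⟩ := hcc
    exact ⟨j, hj, fun h0 => hj0 ((RatFn.functionFieldMap σ).injective (by rw [h0, map_zero]))⟩
  exact cleanPermissibleAt_of_unit_mul_pow p (RatFn.toFunctionField x) (RatFn.toFunctionField_injective x)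
    (RatFn.functionFieldMap σ G) _ _ hcc' U q hUunit hq0 hX' hUres

end Summit.ResolutionOfSingularities.ResolutionOfSingularities.Theorems.RadicialJung.CleanModels

end
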